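import Literature.MathematicalPhysics.QuantumLattice.AnisotropicXYThermalInfraredBound
import HarnessLib

/-!
# Kubo's inequality for the quantum XY model with direction-dependent couplings, with a
# direction-dependent staggering: `Σᵢ σᵢ Kᵢ e₃^{(i)} ≤ Σᵢ Kᵢ e₁^{(i)}` for every sign pattern `σ`

Topic `MathematicalPhysics/QuantumLattice`; sibling of `AnisotropicXYInfraredBound.lean` (ground
state) and `AnisotropicXYThermalInfraredBound.lean` (positive temperature). No named fact is
introduced.

## What is printed, and what is done here

Kennedy–Lieb–Shastry, PRL **61** (1988) 2582, after eq. (4): "Kubo [7] has shown that `|e₃| ≤ e₁`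
(for otherwise the energy could be lowered by interchanging the 1 and 3 spin directions)"; the tree
proves this for the isotropic XY torus with TWO rotations — the global interchange `1 ↔ 3`
(`e₃ ≤ e₁`) and the same followed by the rotation by `π` about the `2`-axis on the odd sublattice
of the bipartite even torus (`-e₃ ≤ e₁`) — at `T = 0` (`kubo_xy_bondCorr_abs_le_holds`) and
`T > 0` (`xy_kubo_thermal`, Peierls–Bogoliubov). For the model with direction-dependent couplings
`H_K = -Σ_xΣᵢKᵢ(S¹_xS¹_{x+eᵢ} + S²_xS²_{x+eᵢ})` ([KLS1988JSP] eq. (5)) the same argument with the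
`π`-rotation applied on the sublattice `{x : Σ_{i ∈ I} xᵢ odd}` for an arbitrary set `I` of
directions (well defined on the even torus) flips the sign of the `S³S³` bond exactly in the
directions `i ∈ I`, and the variational principle gives, for EVERY sign pattern `σ ∈ {±1}^d`,

`Σᵢ σᵢ Kᵢ e₃^{(i)} ≤ Σᵢ Kᵢ e₁^{(i)}`  (`xyAniso_kubo_signed_ground`, `xyAniso_kubo_signed_thermal`),

with the direction-resolved bond correlations `e_α^{(i)}` of KLS's p. 1026. Consequently
`Σᵢ Kᵢ|e₃^{(i)}| ≤ Σᵢ Kᵢ e₁^{(i)}` (any real `K`) and, for `K ≥ 0`, the numerator of the anisotropic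
infrared bound is at most twice the `K`-weighted first-component bond correlation:
`Σᵢ Kᵢ(e₁^{(i)} - e₃^{(i)}cos qᵢ) ≤ 2Σᵢ Kᵢ e₁^{(i)}` — whence the infrared bounds in the form
consumed by the Kennedy–Lieb–Shastry sum-rule argument (`xyAniso_infraredBound_ground_kubo`,
`xyAniso_infraredBound_thermal_kubo`), in which only `ē_K = Σᵢ Kᵢ e₁^{(i)}` and `E^K_q` appear.

## References

* [KLS1988PRL] T. Kennedy, E. H. Lieb, B. S. Shastry, Phys. Rev. Lett. 61 (1988) 2582–2584,
  after eq. (4) (Kubo's inequality and its use in (7)).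
* [Kubo1988PRL] K. Kubo, Phys. Rev. Lett. 61 (1988) 110.
* [KLS1988JSP] T. Kennedy, E. H. Lieb, B. S. Shastry, J. Stat. Phys. 53 (1988) 1019–1030, eq. (5),
  p. 1026 (`ρ₁, ρ₃`).
* [DLS1978] F. J. Dyson, E. H. Lieb, B. Simon, J. Stat. Phys. 18 (1978) 335–383, §2 (sublattice
  rotations on the bipartite torus).
-/

noncomputable section

open Matrix Finset
open scoped ComplexOrder
open Literature.MathematicalPhysics.QuantumLattice
  Literature.MathematicalPhysics.QuantumLattice.SpinOperators Literature.Probability.LatticeModels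
  Literature.Barriers.AtomisticToContinuum.BoseGas

namespace Literature.MathematicalPhysics.QuantumLattice

variable {d : ℕ}

/-! ### The direction-dependent staggering and the two rotations -/

section Rotations

variable (L : ℕ) [NeZero L] (n : ℕ)

/-- The sign of a direction pattern: `s_σ(i) = -1` if `σᵢ` (the direction is staggered), else `1`.
[cite: KLS1988PRL, after eq. (4)] -/
def dirSign (σ : Fin d → Bool) (i : Fin d) : ℝ := if σ i then -1 else 1

/-- **The signed rotation of `H_K`.** On the even torus (`L ≥ 3`) there is, for every direction
pattern `σ`, a unitary `U_σ` (the interchange `1 ↔ 3` followed by the `π`-rotation about the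
`2`-axis on the sublattice `{x : Σ_{σᵢ} xᵢ odd}`) with
`U_σ H_K U_σᴴ = -Σ_xΣᵢ Kᵢ (s_σ(i)·b³(x, x+eᵢ) + b²(x, x+eᵢ))` (`b^α = spinBond`): the `S¹S¹` bonds
become `S³S³` bonds, with a sign flip exactly in the staggered directions.
[cite: KLS1988PRL, after eq. (4)] [cite: DysonLiebSimon1978, §2] -/
theorem exists_unitary_conj_xyAnisoTorus_signed (hL : Even L) (hL3 : 3 ≤ L) (K : Fin d → ℝ)
    (σ : Fin d → Bool) :
    ∃ U ∈ Matrix.unitaryGroup (TensorIndex (TorusSite d L) (n + 1)) ℂ,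
      U * xyAnisoTorus L n K * Uᴴ =
        -∑ x : TorusSite d L, ∑ i : Fin d, ((K i : ℝ) : ℂ) •
          (((dirSign σ i : ℝ) : ℂ) • spinBond n 2 x (x + Pi.single i 1) +
            spinBond n 1 x (x + Pi.single i 1)) := by
  obtain ⟨k, rfl⟩ : ∃ k, L = 2 * k := ⟨L / 2, by obtain ⟨k, hk⟩ := hL; omega⟩
  -- (1) the single-site rotations
  obtain ⟨V, hV, hV', hVz, hVx, hVy⟩ := exists_unitary_conj_spinZ_eq_spinX n
  have hx : Vᴴ * spinX n * V = SpinOperators.spinZ n := by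
    rw [← hVz, ← mul_assoc, ← mul_assoc, hV', one_mul, mul_assoc, hV', mul_one]
  have hy : Vᴴ * spinY n * V = spinY n := by
    conv_lhs => rw [← hVy]
    rw [← mul_assoc, ← mul_assoc, hV', one_mul, mul_assoc, hV', mul_one]
  set R := V * V with hR
  have hRR : R * Rᴴ = 1 := by
    rw [hR, conjTranspose_mul, mul_assoc, ← mul_assoc V Vᴴ, hV, one_mul, hV]
  have hRR' : Rᴴ * R = 1 := by
    rw [hR, conjTranspose_mul, mul_assoc, ← mul_assoc Vᴴ V, hV', one_mul, hV']
  have hRz : R * SpinOperators.spinZ n * Rᴴ = -SpinOperators.spinZ n := by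
    rw [hR, conjTranspose_mul, show V * V * SpinOperators.spinZ n * (Vᴴ * Vᴴ) =
      V * (V * SpinOperators.spinZ n * Vᴴ) * Vᴴ by simp only [mul_assoc], hVz, hVx]
  have hRy : R * spinY n * Rᴴ = spinY n := by
    rw [hR, conjTranspose_mul, show V * V * spinY n * (Vᴴ * Vᴴ) =
      V * (V * spinY n * Vᴴ) * Vᴴ by simp only [mul_assoc], hVy, hVy]
  -- (2) `U₁ = ⨂ Vᴴ`: `b⁰ ↦ b²`, `b¹ ↦ b¹`
  set u₁ : TorusSite d (2 * k) → Matrix (Fin (n + 1)) (Fin (n + 1)) ℂ := fun _ => Vᴴ with hu₁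
  have hu₁a : ∀ z, u₁ z * (u₁ z)ᴴ = 1 := fun _ => by rw [hu₁, conjTranspose_conjTranspose, hV']
  have hu₁b : ∀ z, (u₁ z)ᴴ * u₁ z = 1 := fun _ => by rw [hu₁, conjTranspose_conjTranspose, hV]
  have hb0 : ∀ x y : TorusSite d (2 * k),
      productOp u₁ * spinBond n 0 x y * (productOp u₁)ᴴ = spinBond n 2 x y := by
    intro x y
    rw [productOp_conj_spinBond hu₁a hu₁b, spinVec_zero, hu₁]
    simp only [conjTranspose_conjTranspose, hx]
    rfl
  have hb1 : ∀ x y : TorusSite d (2 * k),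
      productOp u₁ * spinBond n 1 x y * (productOp u₁)ᴴ = spinBond n 1 x y := by
    intro x y
    rw [productOp_conj_spinBond hu₁a hu₁b, spinVec_one, hu₁]
    simp only [conjTranspose_conjTranspose, hy]
    rfl
  -- (3) `U₂ = R` on the sublattice `{x : Σ_{σᵢ} xᵢ odd}`
  set ε : TorusSite d (2 * k) → ZMod 2 := fun x =>
    ∑ j ∈ univ.filter (fun j => σ j), ZMod.castHom (dvd_mul_right 2 k) (ZMod 2) (x j) with hε
  have hεstep : ∀ (x : TorusSite d (2 * k)) (i : Fin d),
      ε (x + Pi.single i 1) = ε x + (if σ i then 1 else 0) := by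
    intro x i
    simp only [hε, Pi.add_apply, map_add, sum_add_distrib, add_right_inj]
    rw [show (∑ j ∈ univ.filter (fun j => σ j), ZMod.castHom (dvd_mul_right 2 k) (ZMod 2)
          ((Pi.single i (1 : ZMod (2 * k)) : TorusSite d (2 * k)) j)) =
        ∑ j ∈ univ.filter (fun j => σ j), (if i = j then (1 : ZMod 2) else 0) from
      sum_congr rfl fun j _ => by
        rw [Pi.single_apply]
        split_ifs with h1 h2 h3
        · rw [map_one]
        · exact absurd h1.symm h2
        · exact absurd h3.symm h1
        · rw [map_zero]]
    rw [sum_ite_eq]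
    simp only [mem_filter, mem_univ, true_and]
  set u₂ : TorusSite d (2 * k) → Matrix (Fin (n + 1)) (Fin (n + 1)) ℂ :=
    fun z => if ε z = 0 then 1 else R with hu₂
  have hu₂a : ∀ z, u₂ z * (u₂ z)ᴴ = 1 := by
    intro z; simp only [hu₂]; split_ifs
    · rw [conjTranspose_one, mul_one]
    · exact hRR
  have hu₂b : ∀ z, (u₂ z)ᴴ * u₂ z = 1 := by
    intro z; simp only [hu₂]; split_ifs
    · rw [conjTranspose_one, mul_one]
    · exact hRR'
  set sgn : TorusSite d (2 * k) → ℂ := fun z => if ε z = 0 then 1 else -1 with hsgn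
  have hu₂z : ∀ z, u₂ z * SpinOperators.spinZ n * (u₂ z)ᴴ = sgn z • SpinOperators.spinZ n := by
    intro z; simp only [hu₂, hsgn]; split_ifs
    · rw [conjTranspose_one, mul_one, one_mul, one_smul]
    · rw [hRz, neg_one_smul]
  have hu₂y : ∀ z, u₂ z * spinY n * (u₂ z)ᴴ = spinY n := by
    intro z; simp only [hu₂]; split_ifs
    · rw [conjTranspose_one, mul_one, one_mul]
    · exact hRy
  -- the sign of a bond in direction `i` is `s_σ(i)`
  have hpair : ∀ (x : TorusSite d (2 * k)) (i : Fin d),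
      sgn x * sgn (x + Pi.single i 1) = ((dirSign σ i : ℝ) : ℂ) := by
    intro x i
    have h01 : ∀ t : ZMod 2, t = 0 ∨ t = 1 := by decide
    simp only [hsgn, hεstep x i, dirSign]
    rcases h01 (ε x) with h0 | h1
    · by_cases hσ : σ i
      · rw [if_pos h0, if_pos hσ, if_neg (by rw [h0]; decide), if_pos hσ]; push_cast; ring
      · rw [if_pos h0, if_neg hσ, if_pos (by rw [h0, add_zero]), if_neg hσ]; push_cast; ring
    · by_cases hσ : σ i
      · rw [if_neg (by rw [h1]; decide), if_pos hσ, if_pos (by rw [h1]; decide), if_pos hσ]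
        push_cast; ring
      · rw [if_neg (by rw [h1]; decide), if_neg hσ, if_neg (by rw [h1, add_zero]; decide),
          if_neg hσ]
        push_cast; ring
  have hc2 : ∀ x y : TorusSite d (2 * k),
      productOp u₂ * spinBond n 2 x y * (productOp u₂)ᴴ = (sgn x * sgn y) • spinBond n 2 x y := by
    intro x y
    rw [productOp_conj_spinBond hu₂a hu₂b, spinVec_two, hu₂z, hu₂z, onSite_smul', onSite_smul',
      smul_mul_smul_comm, smul_mul_smul_comm, mul_comm (sgn y) (sgn x), spinBond, smul_comm,
      ← smul_add]
    rfl
  have hc1 : ∀ x y : TorusSite d (2 * k),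
      productOp u₂ * spinBond n 1 x y * (productOp u₂)ᴴ = spinBond n 1 x y := by
    intro x y
    rw [productOp_conj_spinBond hu₂a hu₂b, spinVec_one, hu₂y, hu₂y, spinBond]
    rfl
  -- (4) the composite unitary
  have hU₁ : productOp u₁ ∈ Matrix.unitaryGroup (TensorIndex (TorusSite d (2 * k)) (n + 1)) ℂ :=
    Matrix.mem_unitaryGroup_iff.2 (productOp_mul_conjTranspose hu₁a)
  have hU₂ : productOp u₂ ∈ Matrix.unitaryGroup (TensorIndex (TorusSite d (2 * k)) (n + 1)) ℂ :=
    Matrix.mem_unitaryGroup_iff.2 (productOp_mul_conjTranspose hu₂a)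
  refine ⟨productOp u₂ * productOp u₁, Submonoid.mul_mem _ hU₂ hU₁, ?_⟩
  rw [xyAnisoTorus_eq_sum (2 * k) n hL3, conjTranspose_mul,
    show productOp u₂ * productOp u₁ *
        -(∑ x : TorusSite d (2 * k), ∑ i : Fin d,
          ((K i : ℝ) : ℂ) • xyBond n x (x + Pi.single i 1)) *
        ((productOp u₁)ᴴ * (productOp u₂)ᴴ) =
      productOp u₂ * (productOp u₁ *
        -(∑ x : TorusSite d (2 * k), ∑ i : Fin d,
          ((K i : ℝ) : ℂ) • xyBond n x (x + Pi.single i 1)) *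
        (productOp u₁)ᴴ) * (productOp u₂)ᴴ by simp only [mul_assoc]]
  have h1 : productOp u₁ *
      -(∑ x : TorusSite d (2 * k), ∑ i : Fin d, ((K i : ℝ) : ℂ) • xyBond n x (x + Pi.single i 1)) *
      (productOp u₁)ᴴ =
      -∑ x : TorusSite d (2 * k), ∑ i : Fin d, ((K i : ℝ) : ℂ) •
        (spinBond n 2 x (x + Pi.single i 1) + spinBond n 1 x (x + Pi.single i 1)) := by
    rw [Matrix.mul_neg, Matrix.neg_mul, Finset.mul_sum, Finset.sum_mul]
    congr 1
    refine sum_congr rfl fun x _ => ?_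
    rw [Finset.mul_sum, Finset.sum_mul]
    refine sum_congr rfl fun i _ => ?_
    rw [Matrix.mul_smul, Matrix.smul_mul, xyBond, Matrix.mul_add, Matrix.add_mul, hb0, hb1]
  rw [h1, Matrix.mul_neg, Matrix.neg_mul, Finset.mul_sum, Finset.sum_mul]
  congr 1
  refine sum_congr rfl fun x _ => ?_
  rw [Finset.mul_sum, Finset.sum_mul]
  refine sum_congr rfl fun i _ => ?_
  rw [Matrix.mul_smul, Matrix.smul_mul, Matrix.mul_add, Matrix.add_mul, hc2, hc1, hpair]

end Rotations

/-! ### The expectation of the signed bond sum in a linear functional -/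

section Expectation

variable (L : ℕ) [NeZero L] (n : ℕ)

/-- Linearity: the real part of a linear functional on the signed weighted bond sum.
[folklore] -/
private theorem re_map_signedBondSum (φ : Op (TorusSite d L) (n + 1) →ₗ[ℂ] ℂ) (K s : Fin d → ℝ) :
    (φ (-∑ x : TorusSite d L, ∑ i : Fin d, ((K i : ℝ) : ℂ) •
        (((s i : ℝ) : ℂ) • spinBond n 2 x (x + Pi.single i 1) +
          spinBond n 1 x (x + Pi.single i 1)))).re =
      -∑ x : TorusSite d L, ∑ i : Fin d, K i *
        (s i * (φ (spinBond n 2 x (x + Pi.single i 1))).re +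
          (φ (spinBond n 1 x (x + Pi.single i 1))).re) := by
  rw [map_neg, Complex.neg_re, map_sum, Complex.re_sum]
  congr 1
  refine sum_congr rfl fun x _ => ?_
  rw [map_sum, Complex.re_sum]
  refine sum_congr rfl fun i _ => ?_
  rw [LinearMap.map_smul, smul_eq_mul, Complex.re_ofReal_mul, map_add, LinearMap.map_smul,
    smul_eq_mul, Complex.add_re, Complex.re_ofReal_mul]

/-- The same for the unsigned `H_K = -Σ_xΣᵢKᵢ(b⁰ + b¹)`. [folklore] -/
private theorem re_map_xyAnisoTorus (hL3 : 3 ≤ L) (φ : Op (TorusSite d L) (n + 1) →ₗ[ℂ] ℂ)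
    (K : Fin d → ℝ) :
    (φ (xyAnisoTorus L n K)).re =
      -∑ x : TorusSite d L, ∑ i : Fin d, K i *
        ((φ (spinBond n 0 x (x + Pi.single i 1))).re +
          (φ (spinBond n 1 x (x + Pi.single i 1))).re) := by
  rw [xyAnisoTorus_eq_sum L n hL3, map_neg, Complex.neg_re, map_sum, Complex.re_sum]
  congr 1
  refine sum_congr rfl fun x _ => ?_
  rw [map_sum, Complex.re_sum]
  refine sum_congr rfl fun i _ => ?_
  rw [LinearMap.map_smul, smul_eq_mul, Complex.re_ofReal_mul, xyBond, map_add, Complex.add_re]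

end Expectation

/-! ### The signed Kubo inequality in the ground state -/

section Ground

variable (L : ℕ) [NeZero L] (n : ℕ) (K : Fin d → ℝ)

/-- **Kubo's inequality with a direction-dependent staggering, ground state**: on the even torus of
side `L ≥ 4`, for every `K` and every direction pattern `σ`,
`Σᵢ s_σ(i) Kᵢ e₃^{(i)} ≤ Σᵢ Kᵢ e₁^{(i)}` for the direction-resolved bond correlations of the tracial
ground state of `H_K` (`E₀(H_K) = E₀(U_σH_KU_σᴴ) ≤ ω_K(U_σH_KU_σᴴ)` and `e₂^{(i)} = e₁^{(i)}`).
[cite: KLS1988PRL, after eq. (4)] [cite: Kubo1988PRL] -/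
theorem xyAniso_kubo_signed_ground (hL : Even L) (h4 : 4 ≤ L) (σ : Fin d → Bool) :
    ∑ i : Fin d, dirSign σ i * K i * xyAnisoDirBondCorr 2 L n K i ≤
      ∑ i : Fin d, K i * xyAnisoDirBondCorr 0 L n K i := by
  have hL3 : 3 ≤ L := by omega
  haveI : Nonempty (TensorIndex (TorusSite d L) (n + 1)) := ⟨fun _ => 0⟩
  have hHerm : (xyAnisoTorus L n K).IsHermitian := xyAnisoTorus_isHermitian L n K
  obtain ⟨U, hU, hUH⟩ := exists_unitary_conj_xyAnisoTorus_signed L n hL hL3 K σ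
  have hHerm' : (U * xyAnisoTorus L n K * Uᴴ).IsHermitian :=
    isHermitian_mul_mul_conjTranspose U hHerm
  have hE0' : (U * xyAnisoTorus L n K * Uᴴ).groundEnergy = (xyAnisoTorus L n K).groundEnergy :=
    Matrix.groundEnergy_unitary_conj hU
  -- the variational principle `E₀(UHUᴴ) ≤ Re ω_H(UHUᴴ)` and `E₀(H) = Re ω_H(H)`
  have hvar := groundEnergy_le_groundStateFunctional_re hHerm hHerm'
  have hE0 : (xyAnisoTorus L n K).groundEnergy =
      ((xyAnisoTorus L n K).groundStateFunctional (xyAnisoTorus L n K)).re := by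
    rw [groundStateFunctional_hamiltonian hHerm, Complex.ofReal_re]
  rw [hE0', hE0, hUH, re_map_signedBondSum, re_map_xyAnisoTorus L n hL3] at hvar
  simp only [re_groundStateFunctional_aniso_spinBond, xyAnisoGroundCorr_one_eq_zero L n K] at hvar
  -- unfold the direction-resolved correlations
  have hLd : (0 : ℝ) < (L : ℝ) ^ d := by
    have : (0 : ℝ) < L := by exact_mod_cast Nat.pos_of_ne_zero (NeZero.ne L)
    positivity
  simp_rw [xyAnisoDirBondCorr_of_neZero, mul_div_assoc', ← sum_div]
  refine div_le_div_of_nonneg_right ?_ hLd.le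
  rw [show ∑ i : Fin d, dirSign σ i * K i *
      ∑ x : TorusSite d L, xyAnisoGroundCorr 2 L n K x (x + Pi.single i 1) =
      ∑ x : TorusSite d L, ∑ i : Fin d, K i *
        (dirSign σ i * xyAnisoGroundCorr 2 L n K x (x + Pi.single i 1)) by
    rw [sum_comm]; refine sum_congr rfl fun i _ => ?_; rw [mul_sum]
    refine sum_congr rfl fun x _ => ?_; ring,
    show ∑ i : Fin d, K i * ∑ x : TorusSite d L, xyAnisoGroundCorr 0 L n K x (x + Pi.single i 1) =
      ∑ x : TorusSite d L, ∑ i : Fin d, K i * xyAnisoGroundCorr 0 L n K x (x + Pi.single i 1) by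
    rw [sum_comm]; refine sum_congr rfl fun i _ => ?_; rw [mul_sum]]
  have hsplit : ∀ x : TorusSite d L, ∀ i : Fin d,
      K i * (dirSign σ i * xyAnisoGroundCorr 2 L n K x (x + Pi.single i 1) +
        xyAnisoGroundCorr 0 L n K x (x + Pi.single i 1)) =
      K i * (dirSign σ i * xyAnisoGroundCorr 2 L n K x (x + Pi.single i 1)) +
        K i * xyAnisoGroundCorr 0 L n K x (x + Pi.single i 1) := fun x i => by ring
  have hsplit0 : ∀ x : TorusSite d L, ∀ i : Fin d,
      K i * (xyAnisoGroundCorr 0 L n K x (x + Pi.single i 1) +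
        xyAnisoGroundCorr 0 L n K x (x + Pi.single i 1)) =
      K i * xyAnisoGroundCorr 0 L n K x (x + Pi.single i 1) +
        K i * xyAnisoGroundCorr 0 L n K x (x + Pi.single i 1) := fun x i => by ring
  simp only [hsplit, hsplit0, sum_add_distrib] at hvar
  linarith

/-- **`Σᵢ Kᵢ |e₃^{(i)}| ≤ Σᵢ Kᵢ e₁^{(i)}` in the ground state** (even `L ≥ 4`, any real `K`): the
signed Kubo inequality for the pattern `σᵢ = [e₃^{(i)} < 0]`. [cite: KLS1988PRL, after eq. (4)] -/
theorem xyAniso_kubo_abs_ground (hL : Even L) (h4 : 4 ≤ L) :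
    ∑ i : Fin d, K i * |xyAnisoDirBondCorr 2 L n K i| ≤
      ∑ i : Fin d, K i * xyAnisoDirBondCorr 0 L n K i := by
  have h := xyAniso_kubo_signed_ground L n K hL h4
    (fun i => decide (xyAnisoDirBondCorr 2 L n K i < 0))
  refine le_trans (le_of_eq (sum_congr rfl fun i _ => ?_)) h
  simp only [dirSign, decide_eq_true_eq]
  split_ifs with hneg
  · rw [abs_of_neg hneg]; ring
  · rw [abs_of_nonneg (not_lt.1 hneg)]; ring

/-- **The numerator of the anisotropic infrared bound** (ground state, `K ≥ 0`, even `L ≥ 4`): for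
every `q`, `Σᵢ Kᵢ(e₁^{(i)} - e₃^{(i)}cos qᵢ) ≤ 2Σᵢ Kᵢ e₁^{(i)}` (Kubo's inequality, as used in
[KLS1988PRL] eq. (7)). [cite: KLS1988PRL, eqs. (4), (7)] -/
theorem xyAniso_infraredNumerator_le_ground (hL : Even L) (h4 : 4 ≤ L) (hK : ∀ i, 0 ≤ K i)
    (q : TorusSite d L) :
    ∑ i : Fin d, K i * (xyAnisoDirBondCorr 0 L n K i -
        xyAnisoDirBondCorr 2 L n K i * Real.cos (latticeMomentum L q i)) ≤
      2 * ∑ i : Fin d, K i * xyAnisoDirBondCorr 0 L n K i := by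
  have habs := xyAniso_kubo_abs_ground L n K hL h4
  have hterm : ∀ i : Fin d, K i * (xyAnisoDirBondCorr 0 L n K i -
      xyAnisoDirBondCorr 2 L n K i * Real.cos (latticeMomentum L q i)) ≤
      K i * xyAnisoDirBondCorr 0 L n K i + K i * |xyAnisoDirBondCorr 2 L n K i| := by
    intro i
    have hc : |Real.cos (latticeMomentum L q i)| ≤ 1 := Real.abs_cos_le_one _
    have h1 : -(xyAnisoDirBondCorr 2 L n K i * Real.cos (latticeMomentum L q i)) ≤
        |xyAnisoDirBondCorr 2 L n K i| := by
      have := neg_abs_le (xyAnisoDirBondCorr 2 L n K i * Real.cos (latticeMomentum L q i))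
      rw [abs_mul] at this
      nlinarith [abs_nonneg (xyAnisoDirBondCorr 2 L n K i)]
    nlinarith [hK i]
  calc _ ≤ ∑ i : Fin d, (K i * xyAnisoDirBondCorr 0 L n K i +
          K i * |xyAnisoDirBondCorr 2 L n K i|) := sum_le_sum fun i _ => hterm i
    _ = ∑ i : Fin d, K i * xyAnisoDirBondCorr 0 L n K i +
          ∑ i : Fin d, K i * |xyAnisoDirBondCorr 2 L n K i| := sum_add_distrib
    _ ≤ _ := by linarith

/-- **The anisotropic ground-state infrared bound, Kubo form** ([KLS1988PRL] eq. (4) with Kubo's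
inequality inserted, anisotropic couplings): even `L ≥ 4`, `K > 0`, `q ≠ 0` ⇒
`(ĝ¹_K(q))² E^K_q ≤ ½ Σᵢ Kᵢ e₁^{(i)}` — only the `K`-weighted first-component bond correlation and
`E^K_q` remain. [cite: KLS1988PRL, eqs. (4), (7)] [cite: KLS1988JSP, eqs. (6)–(7)] -/
theorem xyAniso_infraredBound_ground_kubo (hL : Even L) (h4 : 4 ≤ L) (hK : ∀ i, 0 < K i)
    (q : TorusSite d L) (hq : q ≠ 0) :
    0 ≤ xyAnisoStructureFactor 0 L n K q ∧
      xyAnisoStructureFactor 0 L n K q ^ 2 * NVectorAniso.anisoDispersion K (latticeMomentum L q) ≤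
        (1 / 2 : ℝ) * ∑ i : Fin d, K i * xyAnisoDirBondCorr 0 L n K i := by
  obtain ⟨h0, h1⟩ := xyAniso_infraredBound_ground L n hL h4 hK q hq
  refine ⟨h0, h1.trans ?_⟩
  have h2 := xyAniso_infraredNumerator_le_ground L n K hL h4 (fun i => (hK i).le) q
  linarith

end Ground

/-! ### The signed Kubo inequality at positive temperature -/

section Thermal

variable (L : ℕ) [NeZero L] (n : ℕ) (K : Fin d → ℝ)

/-- **Kubo's inequality with a direction-dependent staggering, positive temperature**: on the even
torus of side `L ≥ 4`, for every `K`, every direction pattern `σ` and `β > 0`,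
`Σᵢ s_σ(i) Kᵢ e₃^{(i)} ≤ Σᵢ Kᵢ e₁^{(i)}` for the direction-resolved thermal bond correlations of
`H_K` (Peierls–Bogoliubov `⟨U_σH_KU_σᴴ - H_K⟩_β ≥ 0`,
`Matrix.re_gibbsState_nonneg_of_unitary_conj`, and `e₂^{(i)} = e₁^{(i)}`).
[cite: KLS1988PRL, after eq. (4)] [cite: Kubo1988PRL] -/
theorem xyAniso_kubo_signed_thermal (hL : Even L) (h4 : 4 ≤ L) (σ : Fin d → Bool) {β : ℝ}
    (hβ : 0 < β) :
    ∑ i : Fin d, dirSign σ i * K i * gibbsDirBondCorr β (xyAnisoTorus L n K) 2 i ≤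
      ∑ i : Fin d, K i * gibbsDirBondCorr β (xyAnisoTorus L n K) 0 i := by
  have hL3 : 3 ≤ L := by omega
  haveI : Nonempty (TensorIndex (TorusSite d L) (n + 1)) := ⟨fun _ => 0⟩
  set H := xyAnisoTorus L n K with hH
  have hHerm : H.IsHermitian := xyAnisoTorus_isHermitian L n K
  obtain ⟨U, hU, hUH⟩ := exists_unitary_conj_xyAnisoTorus_signed L n hL hL3 K σ
  have hU' : U ∈ unitary (Matrix (TensorIndex (TorusSite d L) (n + 1))
      (TensorIndex (TorusSite d L) (n + 1)) ℂ) := hU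
  set W := U * H * Uᴴ - H with hW
  have hWherm : W.IsHermitian := (isHermitian_mul_mul_conjTranspose U hHerm).sub hHerm
  have hUW : U * H * star U = H + W := by rw [star_eq_conjTranspose, hW, add_sub_cancel]
  have hPB := re_gibbsState_nonneg_of_unitary_conj hHerm hβ hU' hWherm hUW
  rw [hW, map_sub, Complex.sub_re, hUH, re_map_signedBondSum, re_map_xyAnisoTorus L n hL3] at hPB
  simp only [re_gibbsState_spinBond' β hHerm] at hPB
  have hS : ∀ z w : TorusSite d L, gibbsSpinCorr β H 1 z w = gibbsSpinCorr β H 0 z w :=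
    fun z w => by rw [gibbsSpinCorr, gibbsSpinCorr, hH, gibbsState_aniso_corr_one_eq_zero]
  simp only [hS] at hPB
  have hLd : (0 : ℝ) < (L : ℝ) ^ d := by
    have : (0 : ℝ) < L := by exact_mod_cast Nat.pos_of_ne_zero (NeZero.ne L)
    positivity
  simp_rw [gibbsDirBondCorr, mul_div_assoc', ← sum_div]
  refine div_le_div_of_nonneg_right ?_ hLd.le
  rw [show ∑ i : Fin d, dirSign σ i * K i *
      ∑ x : TorusSite d L, gibbsSpinCorr β H 2 x (x + Pi.single i 1) =
      ∑ x : TorusSite d L, ∑ i : Fin d, K i *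
        (dirSign σ i * gibbsSpinCorr β H 2 x (x + Pi.single i 1)) by
    rw [sum_comm]; refine sum_congr rfl fun i _ => ?_; rw [mul_sum]
    refine sum_congr rfl fun x _ => ?_; ring,
    show ∑ i : Fin d, K i * ∑ x : TorusSite d L, gibbsSpinCorr β H 0 x (x + Pi.single i 1) =
      ∑ x : TorusSite d L, ∑ i : Fin d, K i * gibbsSpinCorr β H 0 x (x + Pi.single i 1) by
    rw [sum_comm]; refine sum_congr rfl fun i _ => ?_; rw [mul_sum]]
  have hsplit : ∀ x : TorusSite d L, ∀ i : Fin d,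
      K i * (dirSign σ i * gibbsSpinCorr β H 2 x (x + Pi.single i 1) +
        gibbsSpinCorr β H 0 x (x + Pi.single i 1)) =
      K i * (dirSign σ i * gibbsSpinCorr β H 2 x (x + Pi.single i 1)) +
        K i * gibbsSpinCorr β H 0 x (x + Pi.single i 1) := fun x i => by ring
  have hsplit0 : ∀ x : TorusSite d L, ∀ i : Fin d,
      K i * (gibbsSpinCorr β H 0 x (x + Pi.single i 1) +
        gibbsSpinCorr β H 0 x (x + Pi.single i 1)) =
      K i * gibbsSpinCorr β H 0 x (x + Pi.single i 1) +
        K i * gibbsSpinCorr β H 0 x (x + Pi.single i 1) := fun x i => by ring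
  simp only [hsplit, hsplit0, sum_add_distrib] at hPB
  linarith

/-- **`Σᵢ Kᵢ |e₃^{(i)}| ≤ Σᵢ Kᵢ e₁^{(i)}` at positive temperature** (even `L ≥ 4`, `β > 0`, any
real `K`). [cite: KLS1988PRL, after eq. (4)] -/
theorem xyAniso_kubo_abs_thermal (hL : Even L) (h4 : 4 ≤ L) {β : ℝ} (hβ : 0 < β) :
    ∑ i : Fin d, K i * |gibbsDirBondCorr β (xyAnisoTorus L n K) 2 i| ≤
      ∑ i : Fin d, K i * gibbsDirBondCorr β (xyAnisoTorus L n K) 0 i := by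
  have h := xyAniso_kubo_signed_thermal L n K hL h4
    (fun i => decide (gibbsDirBondCorr β (xyAnisoTorus L n K) 2 i < 0)) hβ
  refine le_trans (le_of_eq (sum_congr rfl fun i _ => ?_)) h
  simp only [dirSign, decide_eq_true_eq]
  split_ifs with hneg
  · rw [abs_of_neg hneg]; ring
  · rw [abs_of_nonneg (not_lt.1 hneg)]; ring

/-- **The numerator of the anisotropic infrared bound at positive temperature** (`K ≥ 0`, even
`L ≥ 4`, `β > 0`): `Σᵢ Kᵢ(e₁^{(i)} - e₃^{(i)}cos qᵢ) ≤ 2Σᵢ Kᵢ e₁^{(i)}`.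
[cite: KLS1988PRL, eqs. (4), (7)] -/
theorem xyAniso_infraredNumerator_le_thermal (hL : Even L) (h4 : 4 ≤ L) (hK : ∀ i, 0 ≤ K i)
    {β : ℝ} (hβ : 0 < β) (q : TorusSite d L) :
    ∑ i : Fin d, K i * (gibbsDirBondCorr β (xyAnisoTorus L n K) 0 i -
        gibbsDirBondCorr β (xyAnisoTorus L n K) 2 i * Real.cos (latticeMomentum L q i)) ≤
      2 * ∑ i : Fin d, K i * gibbsDirBondCorr β (xyAnisoTorus L n K) 0 i := by
  have habs := xyAniso_kubo_abs_thermal L n K hL h4 hβ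
  have hterm : ∀ i : Fin d, K i * (gibbsDirBondCorr β (xyAnisoTorus L n K) 0 i -
      gibbsDirBondCorr β (xyAnisoTorus L n K) 2 i * Real.cos (latticeMomentum L q i)) ≤
      K i * gibbsDirBondCorr β (xyAnisoTorus L n K) 0 i +
        K i * |gibbsDirBondCorr β (xyAnisoTorus L n K) 2 i| := by
    intro i
    have hc : |Real.cos (latticeMomentum L q i)| ≤ 1 := Real.abs_cos_le_one _
    have h1 : -(gibbsDirBondCorr β (xyAnisoTorus L n K) 2 i * Real.cos (latticeMomentum L q i)) ≤
        |gibbsDirBondCorr β (xyAnisoTorus L n K) 2 i| := by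
      have := neg_abs_le (gibbsDirBondCorr β (xyAnisoTorus L n K) 2 i *
        Real.cos (latticeMomentum L q i))
      rw [abs_mul] at this
      nlinarith [abs_nonneg (gibbsDirBondCorr β (xyAnisoTorus L n K) 2 i)]
    nlinarith [hK i]
  calc _ ≤ ∑ i : Fin d, (K i * gibbsDirBondCorr β (xyAnisoTorus L n K) 0 i +
          K i * |gibbsDirBondCorr β (xyAnisoTorus L n K) 2 i|) := sum_le_sum fun i _ => hterm i
    _ = ∑ i : Fin d, K i * gibbsDirBondCorr β (xyAnisoTorus L n K) 0 i +
          ∑ i : Fin d, K i * |gibbsDirBondCorr β (xyAnisoTorus L n K) 2 i| := sum_add_distrib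
    _ ≤ _ := by linarith

/-- **The anisotropic infrared bound at positive temperature, Kubo form**: even `L ≥ 4`, `K > 0`,
`β > 0`, `q ≠ 0` ⇒ `0 ≤ ĝ¹_K(q) ≤ 1/(2βE^K_q) + ½[2Σᵢ Kᵢ e₁^{(i)}/E^K_q]^{1/2}` — the form
consumed by the Kennedy–Lieb–Shastry sum-rule argument at `T > 0`.
[cite: KLS1988PRL, eqs. (4), (7)] [cite: DysonLiebSimon1978, Thm. 4.1, eq. (44)] -/
theorem xyAniso_infraredBound_thermal_kubo (hL : Even L) (h4 : 4 ≤ L) (hK : ∀ i, 0 < K i)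
    {β : ℝ} (hβ : 0 < β) (q : TorusSite d L) (hq : q ≠ 0) :
    0 ≤ gibbsStructureFactor β (xyAnisoTorus L n K) 0 q ∧
      gibbsStructureFactor β (xyAnisoTorus L n K) 0 q ≤
        1 / (2 * β * NVectorAniso.anisoDispersion K (latticeMomentum L q)) +
          1 / 2 * Real.sqrt ((2 * ∑ i : Fin d, K i * gibbsDirBondCorr β (xyAnisoTorus L n K) 0 i) /
            NVectorAniso.anisoDispersion K (latticeMomentum L q)) := by
  obtain ⟨h0, h1⟩ := xyAniso_infraredBound_thermal L n hL h4 hK hβ q hq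
  refine ⟨h0, h1.trans ?_⟩
  have hE : 0 < NVectorAniso.anisoDispersion K (latticeMomentum L q) :=
    anisoDispersion_latticeMomentum_pos L hK hq
  have h2 := xyAniso_infraredNumerator_le_thermal L n K hL h4 (fun i => (hK i).le) hβ q
  gcongr

end Thermal

end Literature.MathematicalPhysics.QuantumLattice
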